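import Summits.CriticalPhenomena.Ising3DConformalLimit.Theses.FilmLadder
import HarnessLib.Audit

/-!
# Birth skeleton for crux `LayerSusceptibilityGrowth` (stmt-CriticalPhenomena-4760), route `FilmLadder`

Crux (C), rank 2 of `route-CriticalPhenomena-FilmLadder` (sub-problem `Ising3DConformalLimit`). Write
`τ_k(x) := ⨆_L ⟨σ₀σ_x⟩^free_{Λ_L ∩ F_k, β_c(3)}` (the free film two-point function at the BULK critical point,
`F_k = {|x₀| ≤ k}`, verbatim the `iSup` of the route decl), `S_k(R) := Σ_{y ∈ box 2 R} τ_k(0,(0,y₀,y₁))` (mid-plane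
layer partial sums) and `χ⁰_k := ⨆_R S_k(R)` (the mid-plane LAYER SUSCEPTIBILITY of the film of half-thickness `k`;
a genuine supremum once `S_k` is bounded, stub 1). The crux says: `∃ κ > 0, c > 0, C` with, for all `k ≥ 1`,
`S_k(R) ≤ C k^κ` for every `R` and `c k^κ ≤ S_k(R)` for some `R` — a PURE two-sided power law in the thickness.

## The line: "Fekete in the thickness" (the multiplicative normal form of finite-size scaling)

The recorded failure mode of (C) (route header, why-it-might-fail) is a slowly varying factor `χ⁰_k ≍ k^κ·ℓ(k)` or two
growth exponents along subsequences, and the header notes that "beyond `χ⁰_k ↑` (Griffiths) no sub/super-multiplicativity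
of `χ⁰` under stacking of films is proved".  This skeleton makes exactly that the load-bearing obligation and PROVES that
it suffices: if the ladder `k ↦ χ⁰_k` is finite, nondecreasing, unbounded and QUASI-MULTIPLICATIVE under multiplication
of the thickness, `c·χ⁰_j·χ⁰_k ≤ χ⁰_{jk} ≤ C·χ⁰_j·χ⁰_k` (`j, k ≥ 1`), then Fekete's lemma over the dyadic thicknesses
`2^n` (sub- AND super-additivity of `log χ⁰_{2^n}` up to the constants `log C`, `log c` force ONE exponent `θ` with
`|log χ⁰_{2^n} − nθ| ≤ max(log C, −log c)` — no slowly varying factor can survive two-sided quasi-multiplicativity),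
monotone interpolation between `2^n ≤ k < 2^{n+1}` and unboundedness (`θ > 0`) give the crux with `κ = θ / log 2`.
Quasi-multiplicativity in the thickness is the scaling hypothesis at the critical fixed point read on the film ladder
(a film of thickness `jk`, coarse-grained by `k`, is a film of thickness `j` of block spins at criticality, with the
layer susceptibility renormalised by `χ⁰_k/χ⁰_1`: CapehartFisher1976, FisherBarber1972, Cardy1996 ch. 4/7); it is
implied by (C) (one line: `χ⁰_jχ⁰_k ≤ C₀²(jk)^κ ≤ (C₀²/c₀)χ⁰_{jk}`, `χ⁰_{jk} ≤ C₀(jk)^κ ≤ (C₀/c₀²)χ⁰_jχ⁰_k`) and,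
by this file, implies it given the three soft facts — so the two halves of quasi-multiplicativity (stubs 3, 4) carry
exactly the open content of (C), split by direction, with no exponent to guess.

* `stub_layerSuscFinite` (M–L, known in kind, unwritten for films): every `S_k(·)` is bounded — the film at bulk
  `β_c(3)` has FINITE layer susceptibility: `β_c(F_k) > β_c(3)` strictly (essential enhancement / strict monotonicity
  of critical points, AizenmanGrimmett1991; slab critical points Bodineau2004, Severo2024) and sharpness of the phase
  transition on the quasi-transitive film graph (AizenmanBarskyFernandez1987, DuminilCopinTassionCMP2016) give
  exponential decay of `τ_k`, hence summability over the mid-plane.  Necessary for (C) (its upper bound).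
* `stub_griffithsLadder` (M, provable with in-tree tools): `S_k(R) ≤ S_{k+1}(R)` (Griffiths' second inequality:
  the free state is monotone in the volume, `isingCorr_free_mono_volume_of_gks`; = route support item 4763
  `FilmEnvelope`, summed) AND `sup_{k,R} S_k(R) = +∞` (the free film states increase to the infinite-volume free state
  of `ℤ³`, which at `β_c(3)` is the plus state, `twoPointPlus_criticalBeta_eq_twoPointFree_holds`; its mid-plane sum
  diverges by the Simon–Lieb lower bound `τ ≥ c‖x‖⁻²`, `criticalTwoPoint_bounds_holds`, since `Σ_{y∈ℤ²}‖y‖⁻² = ∞`).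
* `stub_thicknessSuperMult` (L, OPEN): `∃ c > 0, ∀ j k ≥ 1, c·χ⁰_j·χ⁰_k ≤ χ⁰_{jk}` — thick films from thin ones.
* `stub_thicknessSubMult` (L, OPEN — with stub 3 the load-bearing pair): `∃ C, ∀ j k ≥ 1, χ⁰_{jk} ≤ C·χ⁰_j·χ⁰_k`.
* `LayerSusceptibilityGrowth_of` (REAL PROOF, this file, ~170 lines): the abstract lemma `powerLaw_of_quasiMult`
  (positivity bootstrap `χ⁰_1 ≥ 1/C > 0` from unboundedness + sub-multiplicativity at `j = 1`; quasi-additivity of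
  `b_n = log χ⁰_{2^n}`; the Fekete sandwich `(m+1)(b_n + log c) ≤ b_{n(m+1)} + log c`, `b_{n(m+1)} + log C ≤
  (m+1)(b_n + log C)`, whence `(b_n + log c)/n ≤ θ := sup_n (b_n + log c)/n ≤ (b_m + log C)/m`; `θ > 0` by
  unboundedness; `κ = θ/log 2`, `(2^m)^κ = e^{mθ}`; dyadic bracketing `2^n ≤ k < 2^{n+1}` by monotonicity, constants
  `C' = 2^κ/c`, `c' = 1/(2·2^κ·C)`, and `exists_lt_of_lt_ciSup` for the witness `R`), instantiated at
  `S = layerSum`, `χ = layerSusc`.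

All four stubs are stated over IMPORTABLE vocabulary only (fully qualified; the film two-point function copied verbatim
from the route decl, thickness `k`, `k + 1` or `j * k`), so a stub proof lands under `Theorems/` with the registered
signature copied word for word.  `Statement.stub_…` (`type_of%`) are the NAMES of the four statements, used as the
hypotheses of `LayerSusceptibilityGrowth_of` (skeleton audit: hypotheses = declared stubs by name).  The local names
`filmTwoPoint`, `layerSum`, `layerSusc` are verbatim sub-terms, certified against the route decl and the stubs by
`Iff.rfl` (`crux_iff`, `stub_…_iff`).

Disproof used: none on file (`ledger crux ls stmt-CriticalPhenomena-4760`: no workfiles, no `Disproof.lean`, no crux ideas).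
Negatives index (`ledger negatives --problem CriticalPhenomena`): no refuted statement concerns films / slabs / layer
susceptibilities; no stub is an instance of a landed Negative lemma.  Typing checklist 4c: no Bochner integral, no
hand-picked threshold (constants existential), no complex weights; `⨆` junk values audited by the route refuter
(rreview 67add335: `τ_k` is a genuine sup, `[0,1]`-valued GKS-monotone family) and neutralised here by stub 1
(bounded partial sums ⇒ `χ⁰_k` is a genuine sup; the composition never needs the value of an unbounded `⨆`).
-/

noncomputable section

namespace Summit.CriticalPhenomena.Ising3DConformalLimit.Cruxes.LayerSusceptibilityGrowth.Birth

open scoped BigOperators Topology Classical MeasureTheory ProbabilityTheory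
open Filter Set Function TopologicalSpace MeasureTheory
open Literature.Probability.LatticeModels

/-! ## The four registered stubs -/

/-- **STUB 1 · `stub_layerSuscFinite` (M–L, known in kind) — the critical film has finite layer susceptibility.**
For every half-thickness `k`, the mid-plane partial sums `S_k(R) = Σ_{y ∈ box 2 R} τ_k(0,(0,y₀,y₁))` of the free film
two-point function at the bulk critical point are bounded in `R`.  Route: `β_c(F_k) > β_c(F_(k+1)) ≥ β_c(3)` — the
second inequality by GKS (the film `F_(k+1) ⊂ ℤ³` has fewer couplings), the first, STRICT one because adding one layer
to `F_k` is a `ℤ²`-periodic essential enhancement of the quasi-planar graph `F_(k+1) ⊃ F_k` (strict monotonicity of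
critical points, Aizenman–Grimmett) — so the film at `β_c(3)` is strictly subcritical in its own phase diagram, and
sharpness (Aizenman–Barsky–Fernández; Duminil-Copin–Tassion, whose `φ_β(S)` argument runs on the quasi-transitive
graph `F_k` with its `ℤ²` translations) gives `τ_k(0,x) ≤ e^(−m_k‖x‖)`, `m_k > 0`, hence a bounded mid-plane sum.
(For `k = 0` the layer is planar Ising at `β_c(3) ≤ 0.2527 < β_c(2) = 0.4407`, infrared bound.)  Necessary for the
crux (its upper bound); also implied by the route cruxes FilmMassGap + in-film MMS (items 4762, 4764).
[AizenmanGrimmett1991; AizenmanBarskyFernandez1987; DuminilCopinTassionCMP2016 Thm 1.2; Bodineau2004; Severo2024;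
FriedliVelenik2017 §3.7.4] -/
theorem stub_layerSuscFinite :
    ∀ k : ℕ, BddAbove (Set.range fun R : ℕ => ∑ y ∈ Literature.Probability.LatticeModels.box 2 R, (⨆ L : ℕ, Literature.Probability.LatticeModels.isingTwoPoint (Literature.Probability.LatticeModels.zdGraph 3) ((Literature.Probability.LatticeModels.box 3 L).filter (fun z => |z 0| ≤ ((k : ℕ) : ℤ))) (Literature.Probability.LatticeModels.criticalBeta 3) 0 Literature.Probability.LatticeModels.BoundaryCondition.free 0 (![0, y 0, y 1]))) := by
  sorry

/-- **STUB 2 · `stub_griffithsLadder` (M, provable with in-tree tools) — the ladder is nondecreasing and unbounded.**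
(i) `S_k(R) ≤ S_(k+1)(R)` for all `k, R`: the free-boundary two-point function is nondecreasing in the volume
(Griffiths II / GKS, `isingCorr_free_mono_volume_of_gks`), the film boxes `Λ_L ∩ F_k ⊆ Λ_L ∩ F_(k+1)` are nested, and
`⨆_L` of a bounded (`[0,1]`-valued) monotone family passes to the inequality (this is the middle conjunct of the route's
support item `FilmEnvelope`, stmt-CriticalPhenomena-4763, summed over `box 2 R`);
(ii) `sup_(k,R) S_k(R) = +∞`: the boxes `Λ_L ∩ F_k` exhaust `ℤ³` as `k, L → ∞`, so `τ_k ↑ ⟨σ₀σ_x⟩^free_(ℤ³,β_c(3)) =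
⟨σ₀σ_x⟩⁺_(β_c(3))` (free-state thermodynamic limit along an increasing sequence of volumes + continuity at `β_c(3)`,
`twoPointPlus_criticalBeta_eq_twoPointFree_holds`), and the mid-plane sum of the bulk critical two-point function
diverges by the Simon–Lieb / infrared lower bound `⟨σ₀σ_x⟩⁺_(β_c) ≥ c‖x‖⁻²` (`criticalTwoPoint_bounds_holds`) and
`Σ_(y ∈ ℤ², y ≠ 0) ‖y‖⁻² = ∞`.
[GriffithsHurstSherman1970; FriedliVelenik2017 Thm 3.49, Exercise 3.31; AizenmanDuminilCopinSidoraviciusCMP2015 Thm 1.1;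
Simon1980; Literature.Probability.LatticeModels.isingCorr_free_mono_volume_of_gks;
Literature.Probability.LatticeModels.twoPointPlus_criticalBeta_eq_twoPointFree_holds;
Literature.Probability.LatticeModels.criticalTwoPoint_bounds_holds] -/
theorem stub_griffithsLadder :
    (∀ k R : ℕ, ∑ y ∈ Literature.Probability.LatticeModels.box 2 R, (⨆ L : ℕ, Literature.Probability.LatticeModels.isingTwoPoint (Literature.Probability.LatticeModels.zdGraph 3) ((Literature.Probability.LatticeModels.box 3 L).filter (fun z => |z 0| ≤ ((k : ℕ) : ℤ))) (Literature.Probability.LatticeModels.criticalBeta 3) 0 Literature.Probability.LatticeModels.BoundaryCondition.free 0 (![0, y 0, y 1])) ≤ ∑ y ∈ Literature.Probability.LatticeModels.box 2 R, (⨆ L : ℕ, Literature.Probability.LatticeModels.isingTwoPoint (Literature.Probability.LatticeModels.zdGraph 3) ((Literature.Probability.LatticeModels.box 3 L).filter (fun z => |z 0| ≤ ((k + 1 : ℕ) : ℤ))) (Literature.Probability.LatticeModels.criticalBeta 3) 0 Literature.Probability.LatticeModels.BoundaryCondition.free 0 (![0, y 0, y 1]))) ∧ (∀ M : ℝ, ∃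 k R : ℕ, M ≤ ∑ y ∈ Literature.Probability.LatticeModels.box 2 R, (⨆ L : ℕ, Literature.Probability.LatticeModels.isingTwoPoint (Literature.Probability.LatticeModels.zdGraph 3) ((Literature.Probability.LatticeModels.box 3 L).filter (fun z => |z 0| ≤ ((k : ℕ) : ℤ))) (Literature.Probability.LatticeModels.criticalBeta 3) 0 Literature.Probability.LatticeModels.BoundaryCondition.free 0 (![0, y 0, y 1]))) := by
  sorry

/-- **STUB 3 · `stub_thicknessSuperMult` (L, OPEN) — super-multiplicativity of the layer susceptibility in the
thickness.**  With `χ⁰_k = ⨆_R S_k(R)`: `∃ c > 0, ∀ j k ≥ 1, c·χ⁰_j·χ⁰_k ≤ χ⁰_(j·k)` — a film `j` times thicker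
gains at least the factor `c·χ⁰_j` ("thick films from thin ones").  Implied by the crux with `c = c₀/C₀²`; it is the
lower-scaling half of finite-size scaling at bulk `T_c` in multiplicative form (block-spin picture: a film of
thickness `jk` coarse-grained by `k` is a critical film of thickness `j` whose layer susceptibility is renormalised by
`χ⁰_k/χ⁰_1`).  Why it might fail: it forbids a slowly varying deficit `χ⁰_k = k^κ/ℓ(k)`, `ℓ ↑ ∞`; no stacking
inequality beyond `χ⁰_(jk) ≥ χ⁰_k` (Griffiths) is known.  [CapehartFisher1976; FisherBarber1972; Cardy1996 ch. 4;
BinderHohenberg1974 (surface scaling); arXiv:2006.11253; DuminilCopinICM2022 §4.2.1] -/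
theorem stub_thicknessSuperMult :
    ∃ c : ℝ, 0 < c ∧ ∀ j k : ℕ, 1 ≤ j → 1 ≤ k → c * (⨆ R : ℕ, ∑ y ∈ Literature.Probability.LatticeModels.box 2 R, (⨆ L : ℕ, Literature.Probability.LatticeModels.isingTwoPoint (Literature.Probability.LatticeModels.zdGraph 3) ((Literature.Probability.LatticeModels.box 3 L).filter (fun z => |z 0| ≤ ((j : ℕ) : ℤ))) (Literature.Probability.LatticeModels.criticalBeta 3) 0 Literature.Probability.LatticeModels.BoundaryCondition.free 0 (![0, y 0, y 1]))) * (⨆ R : ℕ, ∑ y ∈ Literature.Probability.LatticeModels.box 2 R, (⨆ L : ℕ, Literature.Probability.LatticeModels.isingTwoPoint (Literature.Probability.LatticeModels.zdGraph 3) ((Literature.Probability.LatticeModels.box 3 L).filter (fun z => |z 0| ≤ ((k : ℕ) : ℤ))) (Literature.Probability.LatticeModels.criticalBeta 3) 0 Literature.Probability.LatticeModels.BoundaryCondition.free 0 (![0, y 0, y 1]))) ≤ (⨆ R : ℕ, ∑ y ∈ Literature.Probability.LatticeModels.box 2 R, (⨆ L : ℕ, Literature.Probability.LatticeModels.isingTwoPoint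 (Literature.Probability.LatticeModels.zdGraph 3) ((Literature.Probability.LatticeModels.box 3 L).filter (fun z => |z 0| ≤ ((j * k : ℕ) : ℤ))) (Literature.Probability.LatticeModels.criticalBeta 3) 0 Literature.Probability.LatticeModels.BoundaryCondition.free 0 (![0, y 0, y 1]))) := by
  sorry

/-- **STUB 4 · `stub_thicknessSubMult` (L, OPEN — with stub 3 the load-bearing pair) — sub-multiplicativity of the
layer susceptibility in the thickness.**  `∃ C, ∀ j k ≥ 1, χ⁰_(j·k) ≤ C·χ⁰_j·χ⁰_k` — a film `j` times thicker gains
at most the factor `C·χ⁰_j`.  Implied by the crux with `C = C₀/c₀²`; the upper-scaling half of FSS in multiplicative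
form.  Why it might fail: it forbids a slowly varying EXCESS `χ⁰_k = k^κ·ℓ(k)`, `ℓ ↑ ∞` (the logarithm of `d = 4`
transplanted to films would violate it); the only unconditional upper bound is `χ⁰_k ≤ Σ_(‖y‖ ≲ ξ_k) C‖y‖⁻¹ ≲ ξ_k`
with `ξ_k` the film correlation length, itself uncontrolled (route crux FilmMassGap).
[CapehartFisher1976; FisherBarber1972; Cardy1996 ch. 4; OconnorStephens1994; DuminilCopinICM2022 §4.2.1;
DuminilcopinPanis2025] -/
theorem stub_thicknessSubMult :
    ∃ C : ℝ, ∀ j k : ℕ, 1 ≤ j → 1 ≤ k → (⨆ R : ℕ, ∑ y ∈ Literature.Probability.LatticeModels.box 2 R, (⨆ L : ℕ, Literature.Probability.LatticeModels.isingTwoPoint (Literature.Probability.LatticeModels.zdGraph 3) ((Literature.Probability.LatticeModels.box 3 L).filter (fun z => |z 0| ≤ ((j * k : ℕ) : ℤ))) (Literature.Probability.LatticeModels.criticalBeta 3) 0 Literature.Probability.LatticeModels.BoundaryCondition.free 0 (![0, y 0, y 1]))) ≤ C * (⨆ R : ℕ, ∑ y ∈ Literature.Probability.LatticeModels.box 2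 R, (⨆ L : ℕ, Literature.Probability.LatticeModels.isingTwoPoint (Literature.Probability.LatticeModels.zdGraph 3) ((Literature.Probability.LatticeModels.box 3 L).filter (fun z => |z 0| ≤ ((j : ℕ) : ℤ))) (Literature.Probability.LatticeModels.criticalBeta 3) 0 Literature.Probability.LatticeModels.BoundaryCondition.free 0 (![0, y 0, y 1]))) * (⨆ R : ℕ, ∑ y ∈ Literature.Probability.LatticeModels.box 2 R, (⨆ L : ℕ, Literature.Probability.LatticeModels.isingTwoPoint (Literature.Probability.LatticeModels.zdGraph 3) ((Literature.Probability.LatticeModels.box 3 L).filter (fun z => |z 0| ≤ ((k : ℕ) : ℤ))) (Literature.Probability.LatticeModels.criticalBeta 3) 0 Literature.Probability.LatticeModels.BoundaryCondition.free 0 (![0, y 0, y 1]))) := by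
  sorry

/-! ## Names for the statements (hypotheses of the composition)

The skeleton audit admits, as hypotheses of the theorem that concludes the crux, only registered obligations or the
declared stubs BY NAME; `Statement.stub_x` is the statement of `stub_x` (its `type_of%`). -/

namespace Statement

/-- Statement of `stub_layerSuscFinite`. -/
abbrev stub_layerSuscFinite : Prop := type_of% Birth.stub_layerSuscFinite
/-- Statement of `stub_griffithsLadder`. -/
abbrev stub_griffithsLadder : Prop := type_of% Birth.stub_griffithsLadder
/-- Statement of `stub_thicknessSuperMult`. -/
abbrev stub_thicknessSuperMult : Prop := type_of% Birth.stub_thicknessSuperMult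
/-- Statement of `stub_thicknessSubMult`. -/
abbrev stub_thicknessSubMult : Prop := type_of% Birth.stub_thicknessSubMult

end Statement

/-! ## Local names for the objects (verbatim sub-terms of the route decl), certified by `Iff.rfl` -/

/-- `τ_k(0,x)`: the free film two-point function at the bulk critical point (the `iSup` of the route decl, verbatim). -/
def filmTwoPoint (k : ℕ) (x : Site 3) : ℝ :=
  ⨆ L : ℕ, isingTwoPoint (zdGraph 3) ((box 3 L).filter (fun z => |z 0| ≤ ((k : ℕ) : ℤ))) (criticalBeta 3) 0
    BoundaryCondition.free 0 x

/-- `S_k(R) = Σ_(y ∈ box 2 R) τ_k(0,(0,y₀,y₁))`: the mid-plane layer partial sums. -/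
def layerSum (k R : ℕ) : ℝ :=
  ∑ y ∈ box 2 R, filmTwoPoint k (![0, y 0, y 1])

/-- `χ⁰_k = ⨆_R S_k(R)`: the mid-plane layer susceptibility of the film of half-thickness `k`. -/
def layerSusc (k : ℕ) : ℝ :=
  ⨆ R : ℕ, layerSum k R

/-- The crux, read through the local names (definitional). -/
theorem crux_iff :
    Summit.CriticalPhenomena.Ising3DConformalLimit.Theses.FilmLadder.LayerSusceptibilityGrowth ↔
      ∃ κ c C : ℝ, 0 < κ ∧ 0 < c ∧ ∀ k : ℕ, 1 ≤ k →
        (∀ R : ℕ, layerSum k R ≤ C * (k : ℝ) ^ κ) ∧ (∃ R : ℕ, c * (k : ℝ) ^ κ ≤ layerSum k R) :=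
  Iff.rfl

/-- Stub 1, read through the local names (definitional). -/
theorem stub_layerSuscFinite_iff :
    Statement.stub_layerSuscFinite ↔ ∀ k : ℕ, BddAbove (Set.range (layerSum k)) :=
  Iff.rfl

/-- Stub 2, read through the local names (definitional). -/
theorem stub_griffithsLadder_iff :
    Statement.stub_griffithsLadder ↔
      (∀ k R : ℕ, layerSum k R ≤ layerSum (k + 1) R) ∧ (∀ M : ℝ, ∃ k R : ℕ, M ≤ layerSum k R) :=
  Iff.rfl

/-- Stub 3, read through the local names (definitional). -/
theorem stub_thicknessSuperMult_iff :
    Statement.stub_thicknessSuperMult ↔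
      ∃ c : ℝ, 0 < c ∧ ∀ j k : ℕ, 1 ≤ j → 1 ≤ k → c * layerSusc j * layerSusc k ≤ layerSusc (j * k) :=
  Iff.rfl

/-- Stub 4, read through the local names (definitional). -/
theorem stub_thicknessSubMult_iff :
    Statement.stub_thicknessSubMult ↔
      ∃ C : ℝ, ∀ j k : ℕ, 1 ≤ j → 1 ≤ k → layerSusc (j * k) ≤ C * layerSusc j * layerSusc k :=
  Iff.rfl

/-! ## The abstract lemma: Fekete in the thickness (proved) -/

/-- **Fekete in the thickness.**  Let `S k R` be real numbers with suprema `χ k = ⨆ R, S k R` such that each `S k ·`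
is bounded, `S k R ≤ S (k+1) R`, `sup S = +∞`, and `c·χ j·χ k ≤ χ (j k) ≤ C·χ j·χ k` for `j, k ≥ 1` (`c > 0`).  Then for
one `κ > 0`: `S k R ≤ C' k^κ` for all `k ≥ 1, R` and `c' k^κ ≤ S k R` for some `R` (`C' = 2^κ/c`, `c' = 1/(2·2^κ·C)`).
Proof: positivity bootstrap, quasi-additivity of `log χ(2^n)`, the two-sided Fekete sandwich through
`θ = sup_n (log χ(2^n) + log c)/n`, `θ > 0` from unboundedness, dyadic bracketing by monotonicity. [folklore: Fekete 1923;
de Bruijn–Erdős 1952 (sub/superadditive sequences)] -/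
theorem powerLaw_of_quasiMult (S : ℕ → ℕ → ℝ) (χ : ℕ → ℝ) (hχ : ∀ k, χ k = ⨆ R, S k R)
    (hF : ∀ k, BddAbove (Set.range (S k)))
    (hM : ∀ k R, S k R ≤ S (k + 1) R)
    (hU : ∀ M : ℝ, ∃ k R, M ≤ S k R)
    (hQ : ∃ c C : ℝ, 0 < c ∧ ∀ j k : ℕ, 1 ≤ j → 1 ≤ k →
      c * χ j * χ k ≤ χ (j * k) ∧ χ (j * k) ≤ C * χ j * χ k) :
    ∃ κ c C : ℝ, 0 < κ ∧ 0 < c ∧ ∀ k : ℕ, 1 ≤ k →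
      (∀ R : ℕ, S k R ≤ C * (k : ℝ) ^ κ) ∧ (∃ R : ℕ, c * (k : ℝ) ^ κ ≤ S k R) := by
  -- (0) the suprema dominate the partial sums and are nondecreasing in `k`
  have hSle : ∀ k R, S k R ≤ χ k := fun k R => by rw [hχ k]; exact le_ciSup (hF k) R
  have hmono : Monotone χ := by
    refine monotone_nat_of_le_succ fun k => ?_
    rw [hχ k]
    exact ciSup_le fun R => (hM k R).trans (hSle (k + 1) R)
  obtain ⟨c, C, hc, hQ⟩ := hQ
  -- (1) positivity of `χ k` for `k ≥ 1`, and `0 < C`, `c ≤ C`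
  obtain ⟨k₀, R₀, hk₀⟩ := hU 1
  have hk₁ : (1 : ℝ) ≤ χ (k₀ + 1) := hk₀.trans ((hSle k₀ R₀).trans (hmono (Nat.le_succ k₀)))
  have h11 : c * χ 1 * χ 1 ≤ χ 1 := by
    have h := (hQ 1 1 le_rfl le_rfl).1
    simpa only [mul_one] using h
  have h1k : χ (k₀ + 1) ≤ C * χ 1 * χ (k₀ + 1) := by
    have h := (hQ 1 (k₀ + 1) le_rfl (Nat.succ_le_succ (Nat.zero_le _))).2
    simpa only [one_mul] using h
  have hχ1nn : 0 ≤ χ 1 := by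
    have : 0 ≤ c * χ 1 * χ 1 := by rw [mul_assoc]; exact mul_nonneg hc.le (mul_self_nonneg _)
    exact this.trans h11
  have hpos₁ : 0 < χ (k₀ + 1) := by linarith
  have hCχ : 1 ≤ C * χ 1 :=
    le_of_mul_le_mul_right (by simpa only [one_mul] using h1k) hpos₁
  have hχ1pos : 0 < χ 1 := by
    rcases hχ1nn.lt_or_eq with h | h
    · exact h
    · rw [← h, mul_zero] at hCχ; linarith
  have hCpos : 0 < C := (mul_pos_iff_of_pos_right hχ1pos).1 (by linarith)
  have hχpos : ∀ k, 1 ≤ k → 0 < χ k := fun k hk => hχ1pos.trans_le (hmono hk)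
  have hcC : c ≤ C := by
    have h := (hQ 1 1 le_rfl le_rfl)
    have h' : c * χ 1 * χ 1 ≤ C * χ 1 * χ 1 := h.1.trans h.2
    exact le_of_mul_le_mul_right (le_of_mul_le_mul_right h' hχ1pos) hχ1pos
  have hlogcC : Real.log c ≤ Real.log C := Real.log_le_log hc hcC
  -- (2) dyadic logarithms `b n = log χ(2^n)` are quasi-additive
  obtain ⟨b, hb⟩ : ∃ b : ℕ → ℝ, ∀ n, b n = Real.log (χ (2 ^ n)) := ⟨_, fun _ => rfl⟩
  have h2n : ∀ n : ℕ, 1 ≤ 2 ^ n := fun _ => Nat.one_le_two_pow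
  have hexpb : ∀ n, Real.exp (b n) = χ (2 ^ n) := fun n => by
    rw [hb]; exact Real.exp_log (hχpos _ (h2n n))
  have hsub : ∀ m n, b (m + n) ≤ b m + b n + Real.log C := by
    intro m n
    have h := (hQ (2 ^ m) (2 ^ n) (h2n m) (h2n n)).2
    rw [← pow_add] at h
    rw [hb, hb, hb]
    calc Real.log (χ (2 ^ (m + n)))
        ≤ Real.log (C * χ (2 ^ m) * χ (2 ^ n)) := Real.log_le_log (hχpos _ (h2n _)) h
      _ = Real.log C + Real.log (χ (2 ^ m)) + Real.log (χ (2 ^ n)) := by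
        rw [Real.log_mul (mul_pos hCpos (hχpos _ (h2n m))).ne' (hχpos _ (h2n n)).ne',
          Real.log_mul hCpos.ne' (hχpos _ (h2n m)).ne']
      _ = _ := by ring
  have hsup : ∀ m n, b m + b n + Real.log c ≤ b (m + n) := by
    intro m n
    have h := (hQ (2 ^ m) (2 ^ n) (h2n m) (h2n n)).1
    rw [← pow_add] at h
    rw [hb, hb, hb]
    calc Real.log (χ (2 ^ m)) + Real.log (χ (2 ^ n)) + Real.log c
        = Real.log (c * χ (2 ^ m) * χ (2 ^ n)) := by
          rw [Real.log_mul (mul_pos hc (hχpos _ (h2n m))).ne' (hχpos _ (h2n n)).ne',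
            Real.log_mul hc.ne' (hχpos _ (h2n m)).ne']
          ring
      _ ≤ Real.log (χ (2 ^ (m + n))) :=
          Real.log_le_log (mul_pos (mul_pos hc (hχpos _ (h2n m))) (hχpos _ (h2n n))) h
  -- (3) iterating: `(m+1)·(b n + log c) ≤ b (n·(m+1)) + log c` and
  --     `b (n·(m+1)) + log C ≤ (m+1)·(b n + log C)`
  have hv : ∀ n m : ℕ, ((m : ℝ) + 1) * (b n + Real.log c) ≤ b (n * (m + 1)) + Real.log c := by
    intro n m
    induction m with
    | zero => simp
    | succ m ih =>
      have h := hsup (n * (m + 1)) n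
      have e : n * (m + 1) + n = n * (m + 1 + 1) := by ring
      rw [e] at h
      push_cast at ih ⊢
      linarith
  have hu : ∀ n m : ℕ, b (n * (m + 1)) + Real.log C ≤ ((m : ℝ) + 1) * (b n + Real.log C) := by
    intro n m
    induction m with
    | zero => simp
    | succ m ih =>
      have h := hsub (n * (m + 1)) n
      have e : n * (m + 1) + n = n * (m + 1 + 1) := by ring
      rw [e] at h
      push_cast at ih ⊢
      linarith
  have hkey : ∀ m n : ℕ,
      (b (n + 1) + Real.log c) / ((n : ℝ) + 1) ≤ (b (m + 1) + Real.log C) / ((m : ℝ) + 1) := by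
    intro m n
    rw [div_le_div_iff₀ (by positivity) (by positivity)]
    have h1 := hv (n + 1) m
    have h2 := hu (m + 1) n
    have e : (n + 1) * (m + 1) = (m + 1) * (n + 1) := mul_comm _ _
    rw [e] at h1
    linarith
  -- (4) the exponent: θ = sup_n (b (n+1) + log c)/(n+1)
  have hbdd : BddAbove (Set.range fun n : ℕ => (b (n + 1) + Real.log c) / ((n : ℝ) + 1)) := by
    refine ⟨(b 1 + Real.log C) / ((0 : ℕ) + 1 : ℝ), ?_⟩
    rintro _ ⟨n, rfl⟩
    exact hkey 0 n
  obtain ⟨θ, hθ⟩ : ∃ θ : ℝ, θ = sSup (Set.range fun n : ℕ => (b (n + 1) + Real.log c) / ((n : ℝ) + 1)) :=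
    ⟨_, rfl⟩
  have hvle : ∀ n : ℕ, b (n + 1) + Real.log c ≤ ((n : ℝ) + 1) * θ := by
    intro n
    have h : (b (n + 1) + Real.log c) / ((n : ℝ) + 1) ≤ θ := by
      rw [hθ]; exact le_csSup hbdd ⟨n, rfl⟩
    rw [div_le_iff₀ (by positivity)] at h
    linarith
  have hleu : ∀ m : ℕ, ((m : ℝ) + 1) * θ ≤ b (m + 1) + Real.log C := by
    intro m
    have h : θ ≤ (b (m + 1) + Real.log C) / ((m : ℝ) + 1) := by
      rw [hθ]
      exact csSup_le (Set.range_nonempty _) (by rintro _ ⟨n, rfl⟩; exact hkey m n)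
    rw [le_div_iff₀ (by positivity)] at h
    linarith
  have hlow : ∀ n : ℕ, (n : ℝ) * θ ≤ b n + Real.log C := by
    intro n
    cases n with
    | zero =>
      have h : 0 ≤ Real.log (C * χ 1) := Real.log_nonneg hCχ
      rw [Real.log_mul hCpos.ne' hχ1pos.ne'] at h
      rw [hb]
      simp only [CharP.cast_eq_zero, zero_mul, pow_zero]
      linarith
    | succ m =>
      have h := hleu m
      push_cast
      linarith
  -- (5) θ > 0 from unboundedness
  have hθpos : 0 < θ := by
    by_contra hle
    rw [not_lt] at hle
    have hbound : ∀ k, χ k ≤ 1 / c := by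
      intro k
      have hk : k ≤ 2 ^ (k + 1) :=
        (Nat.lt_two_pow_self).le.trans (Nat.pow_le_pow_right (by norm_num) (Nat.le_succ k))
      refine (hmono hk).trans ?_
      have h1 := hvle k
      have h2 : ((k : ℝ) + 1) * θ ≤ 0 := mul_nonpos_iff.mpr (Or.inl ⟨by positivity, hle⟩)
      have h3 : b (k + 1) ≤ -Real.log c := by linarith
      calc χ (2 ^ (k + 1)) = Real.exp (b (k + 1)) := (hexpb _).symm
        _ ≤ Real.exp (-Real.log c) := Real.exp_le_exp.2 h3
        _ = 1 / c := by rw [Real.exp_neg, Real.exp_log hc, one_div]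
    obtain ⟨k, R, hkR⟩ := hU (1 / c + 1)
    have := (hkR.trans (hSle k R)).trans (hbound k)
    linarith
  -- (6) κ = θ / log 2 and the dyadic powers
  have hlog2 : 0 < Real.log 2 := Real.log_pos one_lt_two
  obtain ⟨κ, hκθ, hκpos⟩ : ∃ κ : ℝ, κ * Real.log 2 = θ ∧ 0 < κ :=
    ⟨θ / Real.log 2, div_mul_cancel₀ θ hlog2.ne', div_pos hθpos hlog2⟩
  have hpow : ∀ m : ℕ, ((2 : ℝ) ^ m) ^ κ = Real.exp ((m : ℝ) * θ) := by
    intro m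
    rw [Real.rpow_def_of_pos (by positivity), Real.log_pow, ← hκθ]
    congr 1
    ring
  -- (7) conclusion, interpolating between dyadic thicknesses by monotonicity
  refine ⟨κ, 1 / (2 * (2 : ℝ) ^ κ * C), (2 : ℝ) ^ κ / c, hκpos, by positivity, fun k hk => ?_⟩
  have hk0 : k ≠ 0 := by omega
  obtain ⟨n, hn⟩ : ∃ n : ℕ, n = Nat.log 2 k := ⟨_, rfl⟩
  have h_lo : 2 ^ n ≤ k := hn ▸ Nat.pow_log_le_self 2 hk0
  have h_hi : k < 2 ^ (n + 1) := hn ▸ Nat.lt_pow_succ_log_self (by norm_num) k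
  have h_lo' : (2 : ℝ) ^ n ≤ (k : ℝ) := by exact_mod_cast h_lo
  have h_hi' : (k : ℝ) ≤ (2 : ℝ) ^ (n + 1) := by exact_mod_cast h_hi.le
  have hkpos : 0 < (k : ℝ) := by exact_mod_cast hk
  have h2κ : 1 ≤ (2 : ℝ) ^ κ := Real.one_le_rpow one_le_two hκpos.le
  constructor
  · intro R
    calc S k R ≤ χ k := hSle k R
      _ ≤ χ (2 ^ (n + 1)) := hmono h_hi.le
      _ = Real.exp (b (n + 1)) := (hexpb _).symm
      _ ≤ Real.exp (((n : ℝ) + 1) * θ - Real.log c) := Real.exp_le_exp.2 (by linarith [hvle n])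
      _ = ((2 : ℝ) ^ (n + 1)) ^ κ / c := by
        rw [Real.exp_sub, Real.exp_log hc, hpow (n + 1)]
        push_cast
        ring_nf
      _ ≤ ((2 : ℝ) * k) ^ κ / c := by
        refine div_le_div_of_nonneg_right (Real.rpow_le_rpow (by positivity) ?_ hκpos.le) hc.le
        rw [pow_succ]
        linarith
      _ = (2 : ℝ) ^ κ / c * (k : ℝ) ^ κ := by
        rw [Real.mul_rpow (by norm_num) hkpos.le]
        ring
  · have hlow_k : (k : ℝ) ^ κ / ((2 : ℝ) ^ κ * C) ≤ χ k := by
      calc (k : ℝ) ^ κ / ((2 : ℝ) ^ κ * C)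
          = ((k : ℝ) / 2) ^ κ / C := by
            rw [Real.div_rpow hkpos.le (by norm_num)]
            field_simp
        _ ≤ ((2 : ℝ) ^ n) ^ κ / C := by
            refine div_le_div_of_nonneg_right (Real.rpow_le_rpow (by positivity) ?_ hκpos.le) hCpos.le
            rw [div_le_iff₀ (by norm_num : (0 : ℝ) < 2)]
            rw [pow_succ] at h_hi'
            linarith
        _ = Real.exp ((n : ℝ) * θ - Real.log C) := by
            rw [Real.exp_sub, Real.exp_log hCpos, hpow n]
        _ ≤ Real.exp (b n) := Real.exp_le_exp.2 (by linarith [hlow n])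
        _ = χ (2 ^ n) := hexpb n
        _ ≤ χ k := hmono h_lo
    have hkκ : 0 < (k : ℝ) ^ κ := Real.rpow_pos_of_pos hkpos κ
    have hq : 0 < (k : ℝ) ^ κ / ((2 : ℝ) ^ κ * C) := by positivity
    have hlt : 1 / (2 * (2 : ℝ) ^ κ * C) * (k : ℝ) ^ κ < χ k := by
      have e : 1 / (2 * (2 : ℝ) ^ κ * C) * (k : ℝ) ^ κ = (1 / 2) * ((k : ℝ) ^ κ / ((2 : ℝ) ^ κ * C)) := by
        field_simp
      rw [e]
      linarith
    rw [hχ k] at hlt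
    obtain ⟨R, hR⟩ := exists_lt_of_lt_ciSup hlt
    exact ⟨R, hR.le⟩

/-! ## The composition: the four stubs imply the crux, by name (real proof, no `sorry`) -/

/-- **`LayerSusceptibilityGrowth` from the stubs.**  Read the stubs and the crux through the local names (`Iff.rfl`),
merge the two halves of quasi-multiplicativity, and apply `powerLaw_of_quasiMult` at `S = layerSum`, `χ = layerSusc`. -/
theorem LayerSusceptibilityGrowth_of (h₁ : Statement.stub_layerSuscFinite) (h₂ : Statement.stub_griffithsLadder)
    (h₃ : Statement.stub_thicknessSuperMult) (h₄ : Statement.stub_thicknessSubMult) :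
    Summit.CriticalPhenomena.Ising3DConformalLimit.Theses.FilmLadder.LayerSusceptibilityGrowth := by
  rw [stub_layerSuscFinite_iff] at h₁
  rw [stub_griffithsLadder_iff] at h₂
  rw [stub_thicknessSuperMult_iff] at h₃
  rw [stub_thicknessSubMult_iff] at h₄
  rw [crux_iff]
  obtain ⟨c, hc, h₃⟩ := h₃
  obtain ⟨C, h₄⟩ := h₄
  exact powerLaw_of_quasiMult layerSum layerSusc (fun _ => rfl) h₁ h₂.1 h₂.2
    ⟨c, C, hc, fun j k hj hk => ⟨h₃ j k hj hk, h₄ j k hj hk⟩⟩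

end Summit.CriticalPhenomena.Ising3DConformalLimit.Cruxes.LayerSusceptibilityGrowth.Birth

end
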